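import Summits.KontsevichZagierPeriods.KontsevichZagierPeriods.Theses.TerasomaMultiplication
import Summits.KontsevichZagierPeriods.KontsevichZagierPeriods.Theorems.TerasomaMultiplicationGapSectorBeyondTwelveSymbol
import Summits.KontsevichZagierPeriods.KontsevichZagierPeriods.Theorems.BetaCancellation.Negative.KernelForm
import Literature.NumberTheory.Transcendental.GammaMonomialsProofs

/-!
# `GapSectorBeyondTwelve` is inhabited: the item pins Das's level-15 identity inside the calculus

Item `GapSectorBeyondTwelve` (stmt-KontsevichZagierPeriods-14858, route `TerasomaMultiplication`) is
crux 5 `GammaHodgeSector` restricted by the extra hypothesis "symbol difference outside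
`RelSpan ⊔ ℤ·g₁₂`".  This file shows that the restriction is NOT vacuous, kernel-checked at all
levels: for Das's level-15 data `N = N' = 1`, `k = 0`, `(x,y) = (4/15,1/5)`, `(x',y') = (1/3,2/15)`
every arithmetic hypothesis of the item is discharged (`das_hodge`, `das_symbol_not_mem` from the
companion files), so the item IMPLIES the KZ-equivalence
`[(0,1), t^{-11/15}(1−t)^{-4/5}] ~ [(0,1), c·t^{-2/3}(1−t)^{-13/15}]` for every real algebraic `c`
with equal values (`dasFifteen_of_gapSectorBeyondTwelve`), and then with NO residual hypothesis
(`dasGapFifteen_of_gapSectorBeyondTwelve`: the constant made explicit,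
`c₀ = Γ(1/5)Γ(4/15)/(Γ(2/15)Γ(1/3))`, real algebraic by the tree's Koblitz–Ogus discharge
`deligne_gammaMonomial_algebraic_holds` — `das_isHodgeType`, `das_constant_isAlgebraic` —, and the
two values computed, `value_of_pinned_betaKernel`) — Das's identity
`B(4/15,1/5) = c₀ B(1/3,2/15)`, `c₀ = Γ(4/15)Γ(1/5)/(Γ(1/3)Γ(2/15))` (the factors `Γ(7/15)` cancel) algebraic
(both CM types `{1,2,4,8} = ker χ₋₁₅ ⊂ (ℤ/15)ˣ`, i.e. both Fermat-quotient factors are isogenous to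
the fourth power of an elliptic curve with CM by `ℚ(√−15)`), whose only known proofs go through
Deligne's absolute Hodge cycles / the Koblitz–Ogus square (`2·class ∈` standard span) and a sign
determination — not through a chain of Kontsevich–Zagier moves.  [Das 2000; Deligne 1982, Thm 7.18;
Koblitz–Ogus 1979; Anderson 2002]
-/

/-! ### The residual sector is inhabited: the item pins Das's level-15 identity -/

namespace Summit.KontsevichZagierPeriods.TerasomaMultiplication.GapSectorBeyondTwelve

open Summit.KontsevichZagierPeriods.KontsevichZagierPeriods.Theses.TerasomaMultiplication
open Summit.KontsevichZagierPeriods.TerasomaMultiplication.GapSectorBeyondTwelveParity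
open Literature.NumberTheory.Transcendental

/-- **The item is inhabited by Das's level-15 pair.** `GapSectorBeyondTwelve` implies the
KZ-equivalence of the Beta representations `[(0,1), t^{4/15−1}(1−t)^{1/5−1}]` (value
`B(4/15,1/5)`) and `[(0,1), c·t^{1/3−1}(1−t)^{2/15−1}]` (value `c·B(1/3,2/15)`) for every real
algebraic `c` making the values agree: all the item's hypotheses are DISCHARGED for the data
`N = N' = 1`, `k = 0`, `(x,y) = (4/15,1/5)`, `(x',y') = (1/3,2/15)` — positivity and
non-integrality, the Hodge-type test (`das_hodge`), and the symbol exclusion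
`[4/15,1/5] − [1/3,2/15] ∉ RelSpan ⊔ ℤ·g₁₂` (`das_symbol_not_mem`, parity distribution `χ₅`).
So the extra hypothesis of the item does not make it vacuous: the item asserts, among infinitely
many others, Das's identity `B(4/15,1/5) = c₀·B(1/3,2/15)` (`c₀` algebraic by Deligne /
Koblitz–Ogus, `deligne_gammaMonomial_algebraic_holds`) INSIDE the Kontsevich–Zagier calculus.
[cite: Das2000, Introduction] -/
theorem dasFifteen_of_gapSectorBeyondTwelve (h : GapSectorBeyondTwelve) (c : ℝ)
    (hc : IsAlgebraic ℚ c) (r r' : KZ.IntegralRep 1)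
    (hd : r.domain = {t | t 0 ∈ Set.Ioo (0:ℝ) 1})
    (hi : Set.EqOn r.integrand (fun t => (t 0) ^ (-(11:ℝ)/15) * (1 - t 0) ^ (-(4:ℝ)/5)) r.domain)
    (hd' : r'.domain = {t | t 0 ∈ Set.Ioo (0:ℝ) 1})
    (hi' : Set.EqOn r'.integrand
      (fun t => c * ((t 0) ^ (-(2:ℝ)/3) * (1 - t 0) ^ (-(13:ℝ)/15))) r'.domain)
    (hv : r.value = r'.value) : KZ.Equivalent r r' := by
  have hnat : ∀ l : Fin 1, (Fin.natAdd (2 * 0) l : Fin (2 * 0 + 1)) = l := fun l => Fin.ext (by simp)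
  refine h 1 1 0 (fun _ => (4:ℚ)/15) (fun _ => (1:ℚ)/5) (fun _ => (1:ℚ)/3) (fun _ => (2:ℚ)/15) c
    ?_ ?_ ?_ hc ?_ r r' ?_ ?_ ?_ ?_ hv
  · intro j
    refine ⟨by norm_num, by norm_num, ?_, ?_⟩
    · show Int.fract ((4:ℚ)/15) ≠ 0
      norm_num [Int.fract_eq_iff]
    · show Int.fract ((1:ℚ)/5) ≠ 0
      norm_num [Int.fract_eq_iff]
  · intro l
    refine ⟨by norm_num, by norm_num, ?_, ?_⟩
    · show Int.fract ((1:ℚ)/3) ≠ 0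
      norm_num [Int.fract_eq_iff]
    · show Int.fract ((2:ℚ)/15) ≠ 0
      norm_num [Int.fract_eq_iff]
  · intro u _ hj _
    have h15 : ((4:ℚ)/15).den = 15 := by norm_num
    have hcop : Nat.Coprime u (((4:ℚ)/15)).den := (hj 0).1
    rw [h15] at hcop
    simp only [Fin.sum_univ_one, Nat.cast_zero]
    exact das_hodge u hcop
  · simp only [Fin.sum_univ_one, zero_smul, sub_zero]
    exact das_symbol_not_mem
  · rw [hd]
    ext t
    simp only [Set.mem_setOf_eq, Fin.forall_fin_one]
  · intro t ht
    rw [hi ht]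
    simp only [Fin.prod_univ_one]
    push_cast
    norm_num
  · rw [hd']
    ext z
    simp only [Set.mem_setOf_eq, Fin.forall_fin_one, hnat]
    simp
  · intro z hz
    rw [hi' hz]
    simp only [Fin.prod_univ_one, hnat, Nat.factorial_zero, Nat.cast_one, mul_one]
    push_cast
    norm_num

end Summit.KontsevichZagierPeriods.TerasomaMultiplication.GapSectorBeyondTwelve

/-! ### Hypothesis-free form: Das's level-15 identity as a pinned pair with explicit constant -/

namespace Summit.KontsevichZagierPeriods.TerasomaMultiplication.GapSectorBeyondTwelve

open MeasureTheory
open Summit.KontsevichZagierPeriods.KontsevichZagierPeriods.Theses.TerasomaMultiplication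
open Summit.KontsevichZagierPeriods.TerasomaMultiplication.GapSectorBeyondTwelveParity
open Literature.NumberTheory.Transcendental
open Summit.KontsevichZagierPeriods.KontsevichZagierPeriods.BetaCancellationNegative
  (betaKernel integrableOn_betaKernel_and_integral_eq)

/-- Expansion of a sum over `{1,…,14}` against the multiplicity vector of Das's Γ-monomial
`Γ(3/15)Γ(4/15)/(Γ(2/15)Γ(5/15))` (support `{2,3,4,5}`). [folklore] -/
theorem das_multiplicities_sum (F : ℕ → ℚ) :
    ∑ i ∈ Finset.Ico 1 15,
      (((fun i : ℕ => if i = 3 then (1:ℤ) else if i = 4 then 1 else if i = 2 then -1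
        else if i = 5 then -1 else 0) i : ℤ) : ℚ) * F i = F 3 + F 4 - F 2 - F 5 := by
  rw [Finset.sum_Ico_eq_sum_range]
  simp [Finset.sum_range_succ]
  ring

/-- Product form of `das_multiplicities_sum`. [folklore] -/
theorem das_multiplicities_prod (G : ℕ → ℂ) :
    ∏ i ∈ Finset.Ico 1 15,
      G i ^ ((fun i : ℕ => if i = 3 then (1:ℤ) else if i = 4 then 1 else if i = 2 then -1
        else if i = 5 then -1 else 0) i) = G 3 * G 4 * (G 2)⁻¹ * (G 5)⁻¹ := by
  rw [Finset.prod_Ico_eq_prod_range]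
  simp only [Finset.prod_range_succ, Finset.prod_range_zero, Nat.reduceSub, Nat.reduceAdd,
    Nat.reduceEqDiff, ↓reduceIte, zpow_zero, zpow_one, zpow_neg, one_mul, mul_one]
  ring

/-- **The Hodge-type test for Das's Γ-monomial** `[3/15]+[4/15]−[2/15]−[5/15]` (weight `0`):
`{3u/15} + {4u/15} = {2u/15} + {5u/15}` for every `u` coprime to `15` — a finite check on
`u mod 15` (both Beta factors have CM type `{1,2,4,8} ⊂ (ℤ/15)ˣ`). [cite: Das2000, Introduction] -/
theorem das_isHodgeType :
    IsHodgeTypeGammaMonomial 15 (fun i : ℕ => if i = 3 then (1:ℤ) else if i = 4 then 1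
      else if i = 2 then -1 else if i = 5 then -1 else 0) 0 := by
  intro u hu
  rw [das_multiplicities_sum]
  have hf : ∀ i : ℕ, Int.fract ((u : ℚ) * (i : ℚ) / ((15 : ℕ) : ℚ)) =
      (((u * i) % 15 : ℕ) : ℚ) / ((15 : ℕ) : ℚ) := by
    intro i
    rw [show (u : ℚ) * (i : ℚ) / ((15 : ℕ) : ℚ) = ((u * i : ℕ) : ℚ) / ((15 : ℕ) : ℚ) by
      push_cast; ring]
    exact Int.fract_div_natCast_eq_div_natCast_mod
  rw [hf 3, hf 4, hf 2, hf 5]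
  have hr15 : u % 15 < 15 := Nat.mod_lt _ (by norm_num)
  have hg : Nat.gcd (u % 15) 15 = 1 := by
    rw [← Nat.gcd_rec]
    exact Nat.Coprime.gcd_eq_one hu.symm
  have key : ∀ r, r < 15 → Nat.gcd r 15 = 1 →
      (r * 3) % 15 + (r * 4) % 15 = (r * 2) % 15 + (r * 5) % 15 := by decide
  have hN := key (u % 15) hr15 hg
  have e : ∀ i : ℕ, (u * i) % 15 = (u % 15 * i) % 15 := fun i =>
    ((Nat.mod_modEq u 15).mul_right i).symm
  rw [← e 3, ← e 4, ← e 2, ← e 5] at hN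
  have hQ : (((u * 3 % 15 : ℕ)) : ℚ) + ((u * 4 % 15 : ℕ) : ℚ) =
      ((u * 2 % 15 : ℕ) : ℚ) + ((u * 5 % 15 : ℕ) : ℚ) := by exact_mod_cast hN
  push_cast
  linear_combination (1/15 : ℚ) * hQ

/-- **Das's constant is algebraic**: `c₀ = Γ(1/5)Γ(4/15)/(Γ(2/15)Γ(1/3)) ∈ ℚ̄ ∩ ℝ`, from the tree's
discharge of Deligne's Thm 7.18 (a) à la Koblitz–Ogus (`deligne_gammaMonomial_algebraic_holds`)
applied to the Hodge-type monomial of `das_isHodgeType` (`d = 15`, `c = 0`).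
[cite: Das2000, Introduction] -/
theorem das_constant_isAlgebraic :
    IsAlgebraic ℚ (Real.Gamma (1/5) * Real.Gamma (4/15) * (Real.Gamma (2/15))⁻¹ *
      (Real.Gamma (1/3))⁻¹) := by
  have hKO := deligne_gammaMonomial_algebraic_holds 15 _ 0 (by norm_num) das_isHodgeType
  unfold gammaTilde at hKO
  rw [das_multiplicities_prod, neg_zero, zpow_zero, one_mul] at hKO
  have hval : (Real.Gamma (((3 : ℕ) : ℝ) / (15 : ℕ)) : ℂ) *
      (Real.Gamma (((4 : ℕ) : ℝ) / (15 : ℕ)) : ℂ) *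
      ((Real.Gamma (((2 : ℕ) : ℝ) / (15 : ℕ)) : ℂ))⁻¹ *
      ((Real.Gamma (((5 : ℕ) : ℝ) / (15 : ℕ)) : ℂ))⁻¹ =
      algebraMap ℝ ℂ (Real.Gamma (1/5) * Real.Gamma (4/15) * (Real.Gamma (2/15))⁻¹ *
        (Real.Gamma (1/3))⁻¹) := by
    rw [Complex.coe_algebraMap]
    push_cast
    norm_num
  rw [hval, isAlgebraic_algebraMap_iff (RCLike.ofReal_injective (K := ℂ))] at hKO
  exact hKO

/-- **Value of a pinned, scaled Beta representation**: if `r : IntegralRep 1` has domain `(0,1)`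
and integrand `c · t^{a−1}(1−t)^{b−1}` there (`0 < a, b`), then `r.value = c · B(a,b)`
(transport along `ℝ¹ ≃ ℝ` and the Beta integral of `…BetaCancellation.Negative.KernelForm`).
[folklore] -/
theorem value_of_pinned_betaKernel {a b : ℚ} (ha : 0 < a) (hb : 0 < b) (c : ℝ)
    (r : KZ.IntegralRep 1) (hd : r.domain = {t | t 0 ∈ Set.Ioo (0:ℝ) 1})
    (hi : Set.EqOn r.integrand (fun t => c * betaKernel a b (t 0)) r.domain) :
    r.value = c * ProbabilityTheory.beta a b := by
  rw [KZ.IntegralRep.value, setIntegral_congr_fun (KZ.IntegralRep.measurableSet_domain_holds r) hi,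
    integral_const_mul, hd, ← (integrableOn_betaKernel_and_integral_eq ha hb).2]
  congr 1
  have hpre : {t : Fin 1 → ℝ | t 0 ∈ Set.Ioo (0:ℝ) 1} =
      (MeasurableEquiv.funUnique (Fin 1) ℝ) ⁻¹' Set.Ioo 0 1 := by
    ext t
    simp [MeasurableEquiv.funUnique]
  have hcomp : (fun x : Fin 1 → ℝ => betaKernel a b (x 0)) =
      betaKernel a b ∘ (MeasurableEquiv.funUnique (Fin 1) ℝ) := by
    funext t
    simp [MeasurableEquiv.funUnique]
  rw [hpre, hcomp]
  exact (volume_preserving_funUnique (Fin 1) ℝ).setIntegral_preimage_emb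
    (MeasurableEquiv.measurableEmbedding _) (betaKernel a b) (Set.Ioo 0 1)

/-- **The item, instantiated with no residual hypothesis** — the level-15 analogue of crux 6
`DasGapTwelve` as a CONSEQUENCE of `GapSectorBeyondTwelve`: any representation pinned as
`[(0,1), t^{-11/15}(1−t)^{-4/5}]` (value `B(4/15,1/5)`) is KZ-equivalent to any representation
pinned as `[(0,1), c₀·t^{-2/3}(1−t)^{-13/15}]`, `c₀ = Γ(1/5)Γ(4/15)/(Γ(2/15)Γ(1/3))` (value
`c₀·B(1/3,2/15) = B(4/15,1/5)`: the values agree by Γ-algebra, and `c₀` is real algebraic by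
Deligne / Koblitz–Ogus, `das_constant_isAlgebraic`).  This is Das's identity inside the calculus,
the first member of the residual Γ-Hodge sector; its only known proofs (Das 2000) go through
absolute Hodge cycles and a sign determination, not through Kontsevich–Zagier moves.
[cite: Das2000, Introduction] -/
theorem dasGapFifteen_of_gapSectorBeyondTwelve (h : GapSectorBeyondTwelve)
    (r r' : KZ.IntegralRep 1) (hd : r.domain = {x | x 0 ∈ Set.Ioo (0:ℝ) 1})
    (hi : Set.EqOn r.integrand (fun x => (x 0) ^ (-(11:ℝ)/15) * (1 - x 0) ^ (-(4:ℝ)/5)) r.domain)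
    (hd' : r'.domain = {x | x 0 ∈ Set.Ioo (0:ℝ) 1})
    (hi' : Set.EqOn r'.integrand (fun x =>
      (Real.Gamma (1/5) * Real.Gamma (4/15) * (Real.Gamma (2/15))⁻¹ * (Real.Gamma (1/3))⁻¹) *
        ((x 0) ^ (-(2:ℝ)/3) * (1 - x 0) ^ (-(13:ℝ)/15))) r'.domain) :
    KZ.Equivalent r r' := by
  refine dasFifteen_of_gapSectorBeyondTwelve h _ das_constant_isAlgebraic r r' hd hi hd' hi' ?_
  -- the two values agree: B(4/15,1/5) = c₀ · B(1/3,2/15)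
  have hv : r.value = 1 * ProbabilityTheory.beta (4/15 : ℚ) (1/5 : ℚ) := by
    refine value_of_pinned_betaKernel (by norm_num) (by norm_num) 1 r hd fun t ht => ?_
    rw [hi ht]
    simp only [betaKernel, one_mul]
    push_cast
    norm_num
  have hv' : r'.value = (Real.Gamma (1/5) * Real.Gamma (4/15) * (Real.Gamma (2/15))⁻¹ *
      (Real.Gamma (1/3))⁻¹) * ProbabilityTheory.beta (1/3 : ℚ) (2/15 : ℚ) := by
    refine value_of_pinned_betaKernel (by norm_num) (by norm_num) _ r' hd' fun t ht => ?_
    rw [hi' ht]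
    simp only [betaKernel]
    push_cast
    norm_num
  rw [hv, hv', ProbabilityTheory.beta, ProbabilityTheory.beta]
  have h3 : Real.Gamma ((1:ℝ)/3) ≠ 0 := (Real.Gamma_pos_of_pos (by norm_num)).ne'
  have h2 : Real.Gamma ((2:ℝ)/15) ≠ 0 := (Real.Gamma_pos_of_pos (by norm_num)).ne'
  have h7 : Real.Gamma ((7:ℝ)/15) ≠ 0 := (Real.Gamma_pos_of_pos (by norm_num)).ne'
  push_cast
  rw [show ((4:ℝ)/15 + 1/5) = 7/15 by norm_num, show ((1:ℝ)/3 + 2/15) = 7/15 by norm_num]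
  field_simp

end Summit.KontsevichZagierPeriods.TerasomaMultiplication.GapSectorBeyondTwelve
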